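import Literature.Analysis.FluidPDE.TypeIRateCubicAbsorption
import Literature.Analysis.FluidPDE.SuitableWeak
import HarnessLib

/-!
# The transported cubic floor of ROUND-27 «THE √2 APEX» (T27-A′, step (iv)): `E(s) ≥ c√(−s)` for the
# cut-off energy near a backward-singular apex (item `TerminalTrace.TypeITraceScarL3`,
# stmt-NavierStokesRegularity-18385, Stub LOUD line; helpers)

Seat nsreg-C26-p1 g2 (cell ns-regularity-ideate), `--supports stmt-NavierStokesRegularity-18385` (helper);
planner-of-record nsreg-p2 g29 (ROUND-27 §1 (v), target `target_cutoffEnergy_floor`).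

* `floor_of_deriv_le_of_late_energy` — REAL ANALYSIS: if `E` is differentiable on `]s₁,0[` with
  `E' ≤ 2m`, and for every `s ∈ ]s₁,0[` some later time `σ ∈ [s, 0[` has `E(σ) ≥ k√(−s)` (`k > 0`), then
  `E(s) ≥ (k/2)√(−s)` on some `]s₂, 0[` (mean value inequality backward from `σ`: the loss `2m(σ − s) ≤ 2m(−s)`
  is of lower order).
* `exists_late_energy_ge_of_cknC_ge` — NAVIER–STOKES INPUT: if the cubic functional at the origin obeys
  `κ ≤ C(r; 0) = r⁻²∫_{Q_r}|U|³` at every radius (the tree's uniform cubic floor at a top singular point,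
  `exists_cknC_ge_of_topSingular`), `U = V` a.e. on the lower slab for a field `V` continuous there with the
  RATE `‖V(τ, y)‖ ≤ C/√(−τ)`, and `φ = 1` on `|y| ≤ ρ₁`, then for every `s ∈ ]−ρ₁², 0[` some `σ ∈ [s, 0[` has
  `∫ ‖φV(σ)‖² ≥ (κ/(2C+1))√(−s)`: otherwise `∫_{Q_r}|U|³ ≤ ∫_{−r²}^{0} (C/√(−τ)) E(τ) dτ < 2C·(κ/(2C+1))·r²`
  with `r = √(−s)`, against `κr² ≤ ∫_{Q_r}|U|³`.

WHAT THIS IS NOT: not T27-A′, not T27-A, not NS regularity.  [folklore; Seregin2014 Prop. 6.20; Seregin–Šverák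
2009 (as11)]
-/

noncomputable section

set_option linter.dupNamespace false

namespace Summit.NavierStokesRegularity.NavierStokesRegularity.Theorems.TypeITraceScarL3

open MeasureTheory Set Function Filter Topology Metric
open Literature.Analysis.FluidPDE
open scoped NNReal ENNReal RealInnerProductSpace

/-! ### Real analysis: transporting a late floor backward -/

/-- **Backward transport of a late floor** (module docstring). [folklore] -/
theorem floor_of_deriv_le_of_late_energy {E E' : ℝ → ℝ} {s₁ m k : ℝ} (hs₁ : s₁ < 0) (hm : 0 ≤ m)
    (hk : 0 < k) (hE : ∀ s ∈ Ioo s₁ 0, HasDerivAt E (E' s) s) (hE' : ∀ s ∈ Ioo s₁ 0, E' s ≤ 2 * m)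
    (hlate : ∀ s ∈ Ioo s₁ 0, ∃ σ ∈ Ico s 0, k * Real.sqrt (-s) ≤ E σ) :
    ∃ c : ℝ, 0 < c ∧ ∃ s₂ : ℝ, s₂ < 0 ∧ s₁ ≤ s₂ ∧ ∀ s ∈ Ioo s₂ 0, c * Real.sqrt (-s) ≤ E s := by
  -- mean value inequality on the convex open interval
  have hconv : Convex ℝ (Ioo s₁ (0 : ℝ)) := convex_Ioo _ _
  have hdiff : DifferentiableOn ℝ E (interior (Ioo s₁ 0)) := by
    rw [interior_Ioo]
    exact fun s hs => (hE s hs).differentiableAt.differentiableWithinAt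
  have hcont : ContinuousOn E (Ioo s₁ 0) := fun s hs => (hE s hs).continuousAt.continuousWithinAt
  have hder : ∀ s ∈ interior (Ioo s₁ (0 : ℝ)), deriv E s ≤ 2 * m := by
    rw [interior_Ioo]
    exact fun s hs => by rw [(hE s hs).deriv]; exact hE' s hs
  have hMV : ∀ s ∈ Ioo s₁ 0, ∀ σ ∈ Ioo s₁ 0, s ≤ σ → E σ - E s ≤ 2 * m * (σ - s) :=
    fun s hs σ hσ hsσ => hconv.image_sub_le_mul_sub_of_deriv_le hcont hdiff hder s hs σ hσ hsσ
  -- the threshold radius `r₀ = k/(4m+1)`: `2m r₀ ≤ k/2`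
  set r₀ : ℝ := k / (4 * m + 1) with hr₀
  have hr₀pos : 0 < r₀ := div_pos hk (by linarith)
  have hr₀m : 2 * m * r₀ ≤ k / 2 := by
    rw [hr₀, mul_div_assoc']
    rw [div_le_div_iff₀ (by linarith) (by norm_num)]
    nlinarith
  refine ⟨k / 2, by linarith, max s₁ (-r₀ ^ 2), max_lt hs₁ (by nlinarith), le_max_left _ _,
    fun s hs => ?_⟩
  have hs₁s : s₁ < s := lt_of_le_of_lt (le_max_left _ _) hs.1
  have hs0 : s < 0 := hs.2
  have hsI : s ∈ Ioo s₁ 0 := ⟨hs₁s, hs0⟩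
  have hr : Real.sqrt (-s) < r₀ := by
    have h1 : -r₀ ^ 2 < s := lt_of_le_of_lt (le_max_right _ _) hs.1
    calc Real.sqrt (-s) < Real.sqrt (r₀ ^ 2) := Real.sqrt_lt_sqrt (by linarith) (by linarith)
      _ = r₀ := Real.sqrt_sq hr₀pos.le
  obtain ⟨σ, hσ, hkσ⟩ := hlate s hsI
  have hσI : σ ∈ Ioo s₁ 0 := ⟨lt_of_lt_of_le hs₁s hσ.1, hσ.2⟩
  have h1 := hMV s hsI σ hσI hσ.1
  have hsq : Real.sqrt (-s) ^ 2 = -s := Real.sq_sqrt (by linarith)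
  have h2 : 2 * m * (σ - s) ≤ 2 * m * (-s) := mul_le_mul_of_nonneg_left (by linarith [hσ.2]) (by linarith)
  have hρnn : 0 ≤ Real.sqrt (-s) := Real.sqrt_nonneg _
  have h3a : 2 * m * Real.sqrt (-s) ≤ k / 2 :=
    le_trans (mul_le_mul_of_nonneg_left hr.le (by linarith)) hr₀m
  have h3 : 2 * m * (-s) ≤ (k / 2) * Real.sqrt (-s) := by
    conv_lhs => rw [← hsq]
    calc 2 * m * Real.sqrt (-s) ^ 2 = Real.sqrt (-s) * (2 * m * Real.sqrt (-s)) := by ring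
      _ ≤ Real.sqrt (-s) * (k / 2) := mul_le_mul_of_nonneg_left h3a hρnn
      _ = (k / 2) * Real.sqrt (-s) := by ring
  linarith

/-! ### The Navier–Stokes input: a late time with energy `≥ k√(−s)` -/

/-- **A late time of large cut-off energy below a cubic floor** (module docstring). [folklore;
Seregin2014 Prop. 6.20; SereginSverak2009 (as11)] -/
theorem exists_late_energy_ge_of_cknC_ge
    {U V : ℝ → EuclideanSpace ℝ (Fin 3) → EuclideanSpace ℝ (Fin 3)} {φ : EuclideanSpace ℝ (Fin 3) → ℝ}
    {κ C ρ₁ : ℝ} (hκ : 0 < κ) (hC : 0 ≤ C) (hρ₁ : 0 < ρ₁)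
    (hcknC : ∀ r : ℝ, 0 < r → ENNReal.ofReal κ ≤ cknC r (0 : ℝ × EuclideanSpace ℝ (Fin 3)) U)
    (hUV : ∀ᵐ z ∂(volume.restrict (Iio (0 : ℝ) ×ˢ (univ : Set (EuclideanSpace ℝ (Fin 3))))),
      U z.1 z.2 = V z.1 z.2)
    (hVc : ContinuousOn (uncurry V) (Iio (0 : ℝ) ×ˢ (univ : Set (EuclideanSpace ℝ (Fin 3)))))
    (hrate : ∀ τ : ℝ, τ < 0 → ∀ y, ‖V τ y‖ ≤ C / Real.sqrt (-τ))
    (hφ1 : ∀ y : EuclideanSpace ℝ (Fin 3), ‖y‖ ≤ ρ₁ → φ y = 1)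
    (hEint : ∀ τ : ℝ, τ < 0 → Integrable (fun y => ‖φ y • V τ y‖ ^ 2)
      (volume : Measure (EuclideanSpace ℝ (Fin 3))))
    {s : ℝ} (hs : s ∈ Ioo (-ρ₁ ^ 2) 0) :
    ∃ σ ∈ Ico s 0, κ / (2 * C + 1) * Real.sqrt (-s) ≤ ∫ y, ‖φ y • V σ y‖ ^ 2 := by
  by_contra hcon
  simp only [not_exists, not_and, not_le] at hcon
  set k : ℝ := κ / (2 * C + 1) with hk
  have hkpos : 0 < k := div_pos hκ (by linarith)
  have hs0 : 0 < -s := by linarith [hs.2]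
  set r : ℝ := Real.sqrt (-s) with hr
  have hrpos : 0 < r := Real.sqrt_pos.2 hs0
  have hr2 : r ^ 2 = -s := Real.sq_sqrt hs0.le
  have hrρ : r < ρ₁ := by
    calc r = Real.sqrt (-s) := rfl
      _ < Real.sqrt (ρ₁ ^ 2) := Real.sqrt_lt_sqrt hs0.le (by linarith [hs.1])
      _ = ρ₁ := Real.sqrt_sq hρ₁.le
  -- the cylinder `Q_r(0) = ]s, 0[ × B_r`
  have hQ : parabolicCylinder r (0 : ℝ × EuclideanSpace ℝ (Fin 3)) =
      Ioo s 0 ×ˢ ball (0 : EuclideanSpace ℝ (Fin 3)) r := by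
    rw [parabolicCylinder]
    simp only [Prod.fst_zero, Prod.snd_zero, zero_sub, hr2, neg_neg]
  have hQm : MeasurableSet (Ioo s 0 ×ˢ ball (0 : EuclideanSpace ℝ (Fin 3)) r) :=
    measurableSet_Ioo.prod measurableSet_ball
  have hQslab : Ioo s 0 ×ˢ ball (0 : EuclideanSpace ℝ (Fin 3)) r ⊆ Iio (0 : ℝ) ×ˢ univ :=
    prod_mono (fun τ hτ => hτ.2) (subset_univ _)
  -- ## lower bound: `κ r² ≤ ∫_{Q_r} |U|³`
  set I : ℝ≥0∞ := ∫⁻ z in Ioo s 0 ×ˢ ball (0 : EuclideanSpace ℝ (Fin 3)) r, ‖U z.1 z.2‖ₑ ^ (3 : ℕ) with hI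
  have hρ0 : ENNReal.ofReal r ≠ 0 := (ENNReal.ofReal_pos.2 hrpos).ne'
  have hρT : ENNReal.ofReal r ≠ ⊤ := ENNReal.ofReal_ne_top
  have hlow : ENNReal.ofReal κ * ENNReal.ofReal r ^ 2 ≤ I := by
    have h := hcknC r hrpos
    rw [cknC, hQ] at h
    have h2 := mul_le_mul' h (le_refl (ENNReal.ofReal r ^ 2))
    rwa [mul_comm ((ENNReal.ofReal r ^ 2)⁻¹) _, mul_assoc,
      ENNReal.inv_mul_cancel (pow_ne_zero _ hρ0) (ENNReal.pow_ne_top hρT), mul_one] at h2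
  -- ## upper bound: `∫_{Q_r} |U|³ = ∫_{Q_r} |V|³ ≤ ∫_s^0 (C/√(−τ)) E(τ) dτ ≤ 2Ck r²`
  have hIV : I = ∫⁻ z in Ioo s 0 ×ˢ ball (0 : EuclideanSpace ℝ (Fin 3)) r, ‖V z.1 z.2‖ₑ ^ (3 : ℕ) := by
    refine lintegral_congr_ae ?_
    filter_upwards [ae_restrict_of_ae_restrict_of_subset hQslab hUV] with z hz
    rw [hz]
  -- pointwise: `‖V‖ₑ³ ≤ ofReal(C/√(−τ)) ‖V‖ₑ²` on the cylinder
  have hpt : ∀ z ∈ Ioo s 0 ×ˢ ball (0 : EuclideanSpace ℝ (Fin 3)) r,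
      ‖V z.1 z.2‖ₑ ^ (3 : ℕ) ≤ ENNReal.ofReal (C / Real.sqrt (-z.1)) * ‖V z.1 z.2‖ₑ ^ (2 : ℕ) := by
    rintro ⟨τ, y⟩ ⟨hτ, -⟩
    have hb : ‖V τ y‖ₑ ≤ ENNReal.ofReal (C / Real.sqrt (-τ)) := by
      rw [← ofReal_norm]
      exact ENNReal.ofReal_le_ofReal (hrate τ hτ.2 y)
    calc ‖V τ y‖ₑ ^ (3 : ℕ) = ‖V τ y‖ₑ * ‖V τ y‖ₑ ^ (2 : ℕ) := by ring
      _ ≤ ENNReal.ofReal (C / Real.sqrt (-τ)) * ‖V τ y‖ₑ ^ (2 : ℕ) := mul_le_mul' hb le_rfl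
  have hup1 : I ≤ ∫⁻ z in Ioo s 0 ×ˢ ball (0 : EuclideanSpace ℝ (Fin 3)) r,
      ENNReal.ofReal (C / Real.sqrt (-z.1)) * ‖V z.1 z.2‖ₑ ^ (2 : ℕ) := by
    rw [hIV]
    exact setLIntegral_mono' hQm hpt
  -- Tonelli on the product
  have hmeas : AEMeasurable (fun z : ℝ × EuclideanSpace ℝ (Fin 3) =>
      ENNReal.ofReal (C / Real.sqrt (-z.1)) * ‖V z.1 z.2‖ₑ ^ (2 : ℕ))
      ((volume.restrict (Ioo s 0)).prod (volume.restrict (ball (0 : EuclideanSpace ℝ (Fin 3)) r))) := by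
    rw [Measure.prod_restrict, ← Measure.volume_eq_prod]
    have hc1 : ContinuousOn (fun z : ℝ × EuclideanSpace ℝ (Fin 3) => C / Real.sqrt (-z.1))
        (Ioo s 0 ×ˢ ball (0 : EuclideanSpace ℝ (Fin 3)) r) := by
      refine ContinuousOn.div continuousOn_const
        (Real.continuous_sqrt.comp (continuous_neg.comp continuous_fst)).continuousOn fun z hz => ?_
      have hz1 : z.1 < 0 := hz.1.2
      exact (Real.sqrt_pos.2 (by linarith : (0 : ℝ) < -z.1)).ne'
    have hm1 : AEMeasurable (fun z : ℝ × EuclideanSpace ℝ (Fin 3) => ENNReal.ofReal (C / Real.sqrt (-z.1)))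
        (volume.restrict (Ioo s 0 ×ˢ ball (0 : EuclideanSpace ℝ (Fin 3)) r)) :=
      (hc1.aemeasurable hQm).ennreal_ofReal
    have hm2 : AEMeasurable (fun z : ℝ × EuclideanSpace ℝ (Fin 3) => ‖V z.1 z.2‖ₑ ^ (2 : ℕ))
        (volume.restrict (Ioo s 0 ×ˢ ball (0 : EuclideanSpace ℝ (Fin 3)) r)) :=
      ((hVc.mono hQslab).aemeasurable hQm).enorm.pow_const 2
    exact hm1.mul hm2
  have hTon : ∫⁻ z in Ioo s 0 ×ˢ ball (0 : EuclideanSpace ℝ (Fin 3)) r,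
      ENNReal.ofReal (C / Real.sqrt (-z.1)) * ‖V z.1 z.2‖ₑ ^ (2 : ℕ) =
      ∫⁻ τ in Ioo s 0, ∫⁻ y in ball (0 : EuclideanSpace ℝ (Fin 3)) r,
        ENNReal.ofReal (C / Real.sqrt (-τ)) * ‖V τ y‖ₑ ^ (2 : ℕ) := by
    rw [Measure.volume_eq_prod, ← Measure.prod_restrict, lintegral_prod _ hmeas]
  -- the slices: `∫_{B_r} ‖V(τ)‖² ≤ E(τ) < k r`
  have hslice : ∀ τ ∈ Ioo s 0, ∫⁻ y in ball (0 : EuclideanSpace ℝ (Fin 3)) r,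
      ENNReal.ofReal (C / Real.sqrt (-τ)) * ‖V τ y‖ₑ ^ (2 : ℕ) ≤
      ENNReal.ofReal (C / Real.sqrt (-τ)) * ENNReal.ofReal (k * r) := by
    intro τ hτ
    rw [lintegral_const_mul' _ _ ENNReal.ofReal_ne_top]
    refine mul_le_mul' le_rfl ?_
    have hEτ := hcon τ ⟨hτ.1.le, hτ.2⟩
    calc ∫⁻ y in ball (0 : EuclideanSpace ℝ (Fin 3)) r, ‖V τ y‖ₑ ^ (2 : ℕ)
        = ∫⁻ y in ball (0 : EuclideanSpace ℝ (Fin 3)) r, ‖φ y • V τ y‖ₑ ^ (2 : ℕ) := by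
          refine setLIntegral_congr_fun measurableSet_ball fun y hy => ?_
          rw [mem_ball_zero_iff] at hy
          simp only [hφ1 y (by linarith), one_smul]
      _ ≤ ∫⁻ y, ‖φ y • V τ y‖ₑ ^ (2 : ℕ) := setLIntegral_le_lintegral _ _
      _ = ENNReal.ofReal (∫ y, ‖φ y • V τ y‖ ^ 2) := by
          rw [ofReal_integral_eq_lintegral_ofReal (hEint τ hτ.2) (Eventually.of_forall fun y => sq_nonneg _)]
          refine lintegral_congr fun y => ?_
          rw [← ofReal_norm, ← ENNReal.ofReal_pow (norm_nonneg _)]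
      _ ≤ ENNReal.ofReal (k * r) := ENNReal.ofReal_le_ofReal hEτ.le
  have hup2 : ∫⁻ τ in Ioo s 0, ∫⁻ y in ball (0 : EuclideanSpace ℝ (Fin 3)) r,
      ENNReal.ofReal (C / Real.sqrt (-τ)) * ‖V τ y‖ₑ ^ (2 : ℕ) ≤
      ∫⁻ τ in Ioo s 0, ENNReal.ofReal (C / Real.sqrt (-τ)) * ENNReal.ofReal (k * r) :=
    setLIntegral_mono' measurableSet_Ioo hslice
  have hmaj : ∫⁻ τ in Ioo s 0, ENNReal.ofReal (C / Real.sqrt (-τ)) * ENNReal.ofReal (k * r) =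
      ENNReal.ofReal (2 * C * r) * ENNReal.ofReal (k * r) := by
    rw [lintegral_mul_const' _ _ ENNReal.ofReal_ne_top]
    congr 1
    have h := typeIRate_lintegral_majorant (K := C) (a := r) (0 : ℝ) hC hrpos.le
    simp only [zero_sub, hr2, sub_neg_eq_add, zero_add] at h
    convert h using 3
  -- ## combine: `κ r² ≤ 2Ck r²`, i.e. `κ ≤ 2Ck < κ`
  have hall : ENNReal.ofReal κ * ENNReal.ofReal r ^ 2 ≤ ENNReal.ofReal (2 * C * r) * ENNReal.ofReal (k * r) :=
    hlow.trans (hup1.trans (hTon.le.trans (hup2.trans hmaj.le)))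
  rw [← ENNReal.ofReal_pow hrpos.le, ← ENNReal.ofReal_mul hκ.le, ← ENNReal.ofReal_mul (by positivity),
    ENNReal.ofReal_le_ofReal_iff (by positivity)] at hall
  have hkC : 2 * C * k < κ := by
    rw [hk, mul_div_assoc', div_lt_iff₀ (by linarith)]
    nlinarith
  have hr2pos : 0 < r ^ 2 := by positivity
  nlinarith

end Summit.NavierStokesRegularity.NavierStokesRegularity.Theorems.TypeITraceScarL3

end
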